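import Literature.Analysis.PDE.Wave1DTrapezoidEnergy
import HarnessLib

/-!
# Exterior-cone energies of `ψ_tt − ψ_xx + V(x)ψ = 0` are non-increasing in `|t|`

Analysis/PDE support file (everything proved). For a `C²` solution `ψ : ℝ → ℝ → ℝ` (time first) of
the wave equation on the line with a continuous potential `V ≥ 0`, and the energy density
`e = ψ_t² + ψ_x² + Vψ²` (written with `deriv` in each variable, as in the tree's Regge–Wheeler
channel items of route PhotonSphereChannels):

* `wave1D_lintegral_Ioi_energy_mono` / `wave1D_lintegral_Iio_energy_mono` — the energy to the right
  of a right-moving point `c + t` (to the left of a left-moving point `c − t`) is non-increasing in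
  `t`, as lower Lebesgue integrals (`∞` allowed; exhaust the half-line by trapezoids,
  `setLIntegral_iUnion_of_directed`);
* `wave1D_timeReversal` — `ψ(−t, x)` is again a solution, with energy density `e(−t, x)`;
* `wave1D_exteriorEnergy_mono_of_nonneg` / `_of_nonpos` / `wave1D_exteriorEnergy_le_initial` — the
  two-sided exterior energy `E_ext(t) = ∫⁻_{ρ + |t| < |x − xc|} e(t,·)` (`ρ ≥ 0`) is non-increasing
  on `t ≥ 0`, non-decreasing on `t ≤ 0`, and `≤ E_ext(0)` — literally the functional `Eext` of the
  items `UniformPhotonSphereChannels`, `FixedModeChannels` (stmt-FinalStateConjecture-10048),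
  `BlindnessInsidePhotonSphere`; in particular their `liminf`s at `±∞` are limits of monotone
  functions.

References: L. C. Evans, *Partial Differential Equations*, 2nd ed. (2010), §2.4.3; standard,
recorded as folklore.
-/

noncomputable section

namespace Literature.Analysis.PDE

open MeasureTheory Set Filter Topology intervalIntegral Literature.Analysis.Calculus

section Exterior

variable {V : ℝ → ℝ} {ψ : ℝ → ℝ → ℝ}

/-- The energy density `ψ_t² + ψ_x² + Vψ²` of a `C²` function (continuous `V`) is jointly continuous.
[folklore] -/
theorem continuous_wave1D_energyDensity (hV : Continuous V) (hψ : ContDiff ℝ 2 (Function.uncurry ψ)) :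
    Continuous fun p : ℝ × ℝ =>
      deriv (fun τ => ψ τ p.2) p.1 ^ 2 + deriv (ψ p.1) p.2 ^ 2 + V p.2 * ψ p.1 p.2 ^ 2 := by
  obtain ⟨ψt, ψx, ψtt, ψtx, ψxx, hct, hcx, -, -, -, h1, h2, -⟩ := exists_partials_of_contDiff_two hψ
  have hd1 : ∀ t x, deriv (fun τ => ψ τ x) t = ψt t x := fun t x => (h1 t x).deriv
  have hd2 : ∀ t x, deriv (ψ t) x = ψx t x := fun t x => (h2 t x).deriv
  simp only [hd1, hd2]
  have ha : Continuous fun p : ℝ × ℝ => ψt p.1 p.2 := hct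
  have hb : Continuous fun p : ℝ × ℝ => ψx p.1 p.2 := hcx
  have hc : Continuous fun p : ℝ × ℝ => ψ p.1 p.2 := hψ.continuous
  have hd : Continuous fun p : ℝ × ℝ => V p.2 := hV.comp continuous_snd
  fun_prop

/-- Energy density of a `C²` function with `V ≥ 0` is non-negative. [folklore] -/
theorem wave1D_energyDensity_nonneg (hV0 : ∀ x, 0 ≤ V x) (t x : ℝ) :
    0 ≤ deriv (fun τ => ψ τ x) t ^ 2 + deriv (ψ t) x ^ 2 + V x * ψ t x ^ 2 := by
  have := hV0 x; positivity

/-- From the interval energy to the lower Lebesgue integral on `Ioc`: for continuous `V`, a `C²`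
function `ψ` and `u ≤ v`,
`∫⁻_{Ioc u v} ofReal e(t,·) = ofReal (∫_u^v e(t,·))`. [folklore] -/
theorem lintegral_Ioc_wave1D_energy_eq (hV : Continuous V) (hV0 : ∀ x, 0 ≤ V x)
    (hψ : ContDiff ℝ 2 (Function.uncurry ψ)) (t : ℝ) {u v : ℝ} (huv : u ≤ v) :
    ∫⁻ x in Ioc u v, ENNReal.ofReal
        (deriv (fun τ => ψ τ x) t ^ 2 + deriv (ψ t) x ^ 2 + V x * ψ t x ^ 2)
      = ENNReal.ofReal (∫ x in u..v,
          (deriv (fun τ => ψ τ x) t ^ 2 + deriv (ψ t) x ^ 2 + V x * ψ t x ^ 2)) := by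
  have hc : Continuous fun x =>
      deriv (fun τ => ψ τ x) t ^ 2 + deriv (ψ t) x ^ 2 + V x * ψ t x ^ 2 :=
    (continuous_wave1D_energyDensity hV hψ).comp (continuous_const.prodMk continuous_id)
  rw [integral_of_le huv, ofReal_integral_eq_lintegral_ofReal hc.integrableOn_Ioc
    (ae_restrict_of_forall_mem measurableSet_Ioc fun x _ => wave1D_energyDensity_nonneg hV0 t x)]

/-- **Outgoing half-line energy is non-increasing** (finite speed of propagation): for a `C²`
solution of `ψ_tt − ψ_xx + V(x)ψ = 0` (`V ≥ 0` continuous) and `s ≤ t`, the energy to the right of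
the right-moving point `c + t` at time `t` is at most the energy to the right of `c + s` at time
`s`: `∫⁻_{x > c+t} e(t,·) ≤ ∫⁻_{x > c+s} e(s,·)` (as lower Lebesgue integrals, `∞` allowed).
[folklore] -/
theorem wave1D_lintegral_Ioi_energy_mono (hV : Continuous V) (hV0 : ∀ x, 0 ≤ V x)
    (hψ : ContDiff ℝ 2 (Function.uncurry ψ))
    (hsol : ∀ t x, iteratedDeriv 2 (fun τ => ψ τ x) t - iteratedDeriv 2 (ψ t) x + V x * ψ t x = 0)
    {c s t : ℝ} (hst : s ≤ t) :
    ∫⁻ x in Ioi (c + t), ENNReal.ofReal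
        (deriv (fun τ => ψ τ x) t ^ 2 + deriv (ψ t) x ^ 2 + V x * ψ t x ^ 2)
      ≤ ∫⁻ x in Ioi (c + s), ENNReal.ofReal
        (deriv (fun τ => ψ τ x) s ^ 2 + deriv (ψ s) x ^ 2 + V x * ψ s x ^ 2) := by
  have hunion : Ioi (c + t) = ⋃ n : ℕ, Ioc (c + t) (c + t + n) := by
    ext x
    simp only [mem_iUnion, mem_Ioc, mem_Ioi]
    constructor
    · intro h
      obtain ⟨n, hn⟩ := exists_nat_gt (x - (c + t))
      exact ⟨n, h, by linarith⟩
    · rintro ⟨n, h1, _⟩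
      exact h1
  have hdir : Directed (· ⊆ ·) fun n : ℕ => Ioc (c + t) (c + t + n) :=
    Monotone.directed_le fun m n hmn => Ioc_subset_Ioc le_rfl (by
      have : (m : ℝ) ≤ n := by exact_mod_cast hmn
      linarith)
  rw [hunion, setLIntegral_iUnion_of_directed _ hdir]
  refine iSup_le fun n => ?_
  -- trapezoid with base `[c + s, c + 2t + n - s]` and top `[c + t, c + t + n]`
  have hmono := wave1D_trapezoid_energy_mono hV hV0 hψ hsol (a := c) (b := c + 2 * t + n) hst
    (by have : (0 : ℝ) ≤ n := n.cast_nonneg; linarith)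
  have htop : c + 2 * t + n - t = c + t + n := by ring
  rw [htop] at hmono
  rw [lintegral_Ioc_wave1D_energy_eq hV hV0 hψ t (by have : (0 : ℝ) ≤ n := n.cast_nonneg; linarith)]
  calc ENNReal.ofReal (∫ x in (c + t)..(c + t + n),
          (deriv (fun τ => ψ τ x) t ^ 2 + deriv (ψ t) x ^ 2 + V x * ψ t x ^ 2))
      ≤ ENNReal.ofReal (∫ x in (c + s)..(c + 2 * t + n - s),
          (deriv (fun τ => ψ τ x) s ^ 2 + deriv (ψ s) x ^ 2 + V x * ψ s x ^ 2)) :=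
        ENNReal.ofReal_le_ofReal hmono
    _ = ∫⁻ x in Ioc (c + s) (c + 2 * t + n - s), ENNReal.ofReal
          (deriv (fun τ => ψ τ x) s ^ 2 + deriv (ψ s) x ^ 2 + V x * ψ s x ^ 2) :=
        (lintegral_Ioc_wave1D_energy_eq hV hV0 hψ s (by
          have : (0 : ℝ) ≤ n := n.cast_nonneg; linarith)).symm
    _ ≤ _ := lintegral_mono_set Ioc_subset_Ioi_self

/-- **Incoming half-line energy is non-increasing**: for a `C²` solution of
`ψ_tt − ψ_xx + V(x)ψ = 0` (`V ≥ 0` continuous) and `s ≤ t`, the energy to the left of the left-moving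
point `c − t` at time `t` is at most the energy to the left of `c − s` at time `s`:
`∫⁻_{x < c−t} e(t,·) ≤ ∫⁻_{x < c−s} e(s,·)`. [folklore] -/
theorem wave1D_lintegral_Iio_energy_mono (hV : Continuous V) (hV0 : ∀ x, 0 ≤ V x)
    (hψ : ContDiff ℝ 2 (Function.uncurry ψ))
    (hsol : ∀ t x, iteratedDeriv 2 (fun τ => ψ τ x) t - iteratedDeriv 2 (ψ t) x + V x * ψ t x = 0)
    {c s t : ℝ} (hst : s ≤ t) :
    ∫⁻ x in Iio (c - t), ENNReal.ofReal
        (deriv (fun τ => ψ τ x) t ^ 2 + deriv (ψ t) x ^ 2 + V x * ψ t x ^ 2)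
      ≤ ∫⁻ x in Iio (c - s), ENNReal.ofReal
        (deriv (fun τ => ψ τ x) s ^ 2 + deriv (ψ s) x ^ 2 + V x * ψ s x ^ 2) := by
  rw [setLIntegral_congr (Iio_ae_eq_Iic (μ := volume) (a := c - t)),
    setLIntegral_congr (Iio_ae_eq_Iic (μ := volume) (a := c - s))]
  have hunion : Iic (c - t) = ⋃ n : ℕ, Ioc (c - t - n) (c - t) := by
    ext x
    simp only [mem_iUnion, mem_Ioc, mem_Iic]
    constructor
    · intro h
      obtain ⟨n, hn⟩ := exists_nat_gt (c - t - x)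
      exact ⟨n, by linarith, h⟩
    · rintro ⟨n, _, h2⟩
      exact h2
  have hdir : Directed (· ⊆ ·) fun n : ℕ => Ioc (c - t - n) (c - t) :=
    Monotone.directed_le fun m n hmn => Ioc_subset_Ioc (by
      have : (m : ℝ) ≤ n := by exact_mod_cast hmn
      linarith) le_rfl
  rw [hunion, setLIntegral_iUnion_of_directed _ hdir]
  refine iSup_le fun n => ?_
  -- trapezoid with base `[c - 2t - n + s, c - s]` and top `[c - t - n, c - t]`
  have hmono := wave1D_trapezoid_energy_mono hV hV0 hψ hsol (a := c - 2 * t - n) (b := c) hst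
    (by have : (0 : ℝ) ≤ n := n.cast_nonneg; linarith)
  have htop : c - 2 * t - n + t = c - t - n := by ring
  rw [htop] at hmono
  rw [lintegral_Ioc_wave1D_energy_eq hV hV0 hψ t (by have : (0 : ℝ) ≤ n := n.cast_nonneg; linarith)]
  calc ENNReal.ofReal (∫ x in (c - t - n)..(c - t),
          (deriv (fun τ => ψ τ x) t ^ 2 + deriv (ψ t) x ^ 2 + V x * ψ t x ^ 2))
      ≤ ENNReal.ofReal (∫ x in (c - 2 * t - n + s)..(c - s),
          (deriv (fun τ => ψ τ x) s ^ 2 + deriv (ψ s) x ^ 2 + V x * ψ s x ^ 2)) :=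
        ENNReal.ofReal_le_ofReal hmono
    _ = ∫⁻ x in Ioc (c - 2 * t - n + s) (c - s), ENNReal.ofReal
          (deriv (fun τ => ψ τ x) s ^ 2 + deriv (ψ s) x ^ 2 + V x * ψ s x ^ 2) :=
        (lintegral_Ioc_wave1D_energy_eq hV hV0 hψ s (by
          have : (0 : ℝ) ≤ n := n.cast_nonneg; linarith)).symm
    _ ≤ _ := lintegral_mono_set Ioc_subset_Iic_self

/-- **Time reversal**: if `ψ` is a `C²` solution of `ψ_tt − ψ_xx + V(x)ψ = 0`, so is
`(t, x) ↦ ψ(−t, x)`, with energy density `e(−t, x)`. [folklore] -/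
theorem wave1D_timeReversal (hψ : ContDiff ℝ 2 (Function.uncurry ψ))
    (hsol : ∀ t x, iteratedDeriv 2 (fun τ => ψ τ x) t - iteratedDeriv 2 (ψ t) x + V x * ψ t x = 0) :
    ContDiff ℝ 2 (Function.uncurry fun t x => ψ (-t) x) ∧
    (∀ t x, iteratedDeriv 2 (fun τ => (fun t x => ψ (-t) x) τ x) t
        - iteratedDeriv 2 ((fun t x => ψ (-t) x) t) x + V x * (fun t x => ψ (-t) x) t x = 0) ∧
    (∀ t x, deriv (fun τ => (fun t x => ψ (-t) x) τ x) t ^ 2 = deriv (fun τ => ψ τ x) (-t) ^ 2) := by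
  refine ⟨?_, fun t x => ?_, fun t x => ?_⟩
  · have : (Function.uncurry fun t x => ψ (-t) x) = Function.uncurry ψ ∘ fun p : ℝ × ℝ => (-p.1, p.2) := by
      funext p; rfl
    rw [this]
    exact hψ.comp (contDiff_neg.prodMap contDiff_id)
  · have h := hsol (-t) x
    have h2 : iteratedDeriv 2 (fun τ => ψ (-τ) x) t = iteratedDeriv 2 (fun τ => ψ τ x) (-t) := by
      rw [iteratedDeriv_comp_neg 2 (fun τ => ψ τ x) t]
      norm_num
    simpa [h2] using h
  · simp only [deriv_comp_neg (fun τ => ψ τ x) t, even_two.neg_pow]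

/-- Far (right) channel energy with the `|t|`-parametrised edge, forward in time: for `0 ≤ s ≤ t`,
`∫⁻_{x > c + |t|} e(t,·) ≤ ∫⁻_{x > c + |s|} e(s,·)`. [folklore] -/
theorem wave1D_farEnergy_mono_of_nonneg (hV : Continuous V) (hV0 : ∀ x, 0 ≤ V x)
    (hψ : ContDiff ℝ 2 (Function.uncurry ψ))
    (hsol : ∀ t x, iteratedDeriv 2 (fun τ => ψ τ x) t - iteratedDeriv 2 (ψ t) x + V x * ψ t x = 0)
    (c : ℝ) {s t : ℝ} (h0s : 0 ≤ s) (hst : s ≤ t) :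
    ∫⁻ x in Ioi (c + |t|), ENNReal.ofReal
        (deriv (fun τ => ψ τ x) t ^ 2 + deriv (ψ t) x ^ 2 + V x * ψ t x ^ 2)
      ≤ ∫⁻ x in Ioi (c + |s|), ENNReal.ofReal
        (deriv (fun τ => ψ τ x) s ^ 2 + deriv (ψ s) x ^ 2 + V x * ψ s x ^ 2) := by
  rw [abs_of_nonneg h0s, abs_of_nonneg (h0s.trans hst)]
  exact wave1D_lintegral_Ioi_energy_mono hV hV0 hψ hsol hst

/-- Far (right) channel energy with the `|t|`-parametrised edge, backward in time: for `t ≤ s ≤ 0`,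
`∫⁻_{x > c + |t|} e(t,·) ≤ ∫⁻_{x > c + |s|} e(s,·)` (time reversal). [folklore] -/
theorem wave1D_farEnergy_mono_of_nonpos (hV : Continuous V) (hV0 : ∀ x, 0 ≤ V x)
    (hψ : ContDiff ℝ 2 (Function.uncurry ψ))
    (hsol : ∀ t x, iteratedDeriv 2 (fun τ => ψ τ x) t - iteratedDeriv 2 (ψ t) x + V x * ψ t x = 0)
    (c : ℝ) {s t : ℝ} (hs0 : s ≤ 0) (hts : t ≤ s) :
    ∫⁻ x in Ioi (c + |t|), ENNReal.ofReal
        (deriv (fun τ => ψ τ x) t ^ 2 + deriv (ψ t) x ^ 2 + V x * ψ t x ^ 2)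
      ≤ ∫⁻ x in Ioi (c + |s|), ENNReal.ofReal
        (deriv (fun τ => ψ τ x) s ^ 2 + deriv (ψ s) x ^ 2 + V x * ψ s x ^ 2) := by
  obtain ⟨hψ', hsol', he'⟩ := wave1D_timeReversal hψ hsol
  have h := wave1D_farEnergy_mono_of_nonneg hV hV0 hψ' hsol' c (s := -s) (t := -t)
    (by linarith) (by linarith)
  simp only [he', abs_neg, neg_neg] at h
  exact h

/-- Near (left) channel energy with the `|t|`-parametrised edge, forward in time: for `0 ≤ s ≤ t`,
`∫⁻_{x < c − |t|} e(t,·) ≤ ∫⁻_{x < c − |s|} e(s,·)`. [folklore] -/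
theorem wave1D_nearEnergy_mono_of_nonneg (hV : Continuous V) (hV0 : ∀ x, 0 ≤ V x)
    (hψ : ContDiff ℝ 2 (Function.uncurry ψ))
    (hsol : ∀ t x, iteratedDeriv 2 (fun τ => ψ τ x) t - iteratedDeriv 2 (ψ t) x + V x * ψ t x = 0)
    (c : ℝ) {s t : ℝ} (h0s : 0 ≤ s) (hst : s ≤ t) :
    ∫⁻ x in Iio (c - |t|), ENNReal.ofReal
        (deriv (fun τ => ψ τ x) t ^ 2 + deriv (ψ t) x ^ 2 + V x * ψ t x ^ 2)
      ≤ ∫⁻ x in Iio (c - |s|), ENNReal.ofReal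
        (deriv (fun τ => ψ τ x) s ^ 2 + deriv (ψ s) x ^ 2 + V x * ψ s x ^ 2) := by
  rw [abs_of_nonneg h0s, abs_of_nonneg (h0s.trans hst)]
  exact wave1D_lintegral_Iio_energy_mono hV hV0 hψ hsol hst

/-- Near (left) channel energy with the `|t|`-parametrised edge, backward in time: for `t ≤ s ≤ 0`,
`∫⁻_{x < c − |t|} e(t,·) ≤ ∫⁻_{x < c − |s|} e(s,·)` (time reversal). [folklore] -/
theorem wave1D_nearEnergy_mono_of_nonpos (hV : Continuous V) (hV0 : ∀ x, 0 ≤ V x)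
    (hψ : ContDiff ℝ 2 (Function.uncurry ψ))
    (hsol : ∀ t x, iteratedDeriv 2 (fun τ => ψ τ x) t - iteratedDeriv 2 (ψ t) x + V x * ψ t x = 0)
    (c : ℝ) {s t : ℝ} (hs0 : s ≤ 0) (hts : t ≤ s) :
    ∫⁻ x in Iio (c - |t|), ENNReal.ofReal
        (deriv (fun τ => ψ τ x) t ^ 2 + deriv (ψ t) x ^ 2 + V x * ψ t x ^ 2)
      ≤ ∫⁻ x in Iio (c - |s|), ENNReal.ofReal
        (deriv (fun τ => ψ τ x) s ^ 2 + deriv (ψ s) x ^ 2 + V x * ψ s x ^ 2) := by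
  obtain ⟨hψ', hsol', he'⟩ := wave1D_timeReversal hψ hsol
  have h := wave1D_nearEnergy_mono_of_nonneg hV hV0 hψ' hsol' c (s := -s) (t := -t)
    (by linarith) (by linarith)
  simp only [he', abs_neg, neg_neg] at h
  exact h

/-- **Two-sided exterior energy is non-increasing forward in time.** For a `C²` solution of
`ψ_tt − ψ_xx + V(x)ψ = 0` on `ℝ²` (`V ≥ 0` continuous), a centre `xc`, a radius `ρ ≥ 0` and
`0 ≤ s ≤ t`: the energy outside the cone, `E_ext(t) = ∫⁻_{ρ + |t| < |x − xc|} (ψ_t² + ψ_x² + Vψ²)(t,·)`,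
satisfies `E_ext(t) ≤ E_ext(s)`. (Exactly the functional `Eext` of the Regge–Wheeler channel items
of route PhotonSphereChannels.) [folklore] -/
theorem wave1D_exteriorEnergy_mono_of_nonneg (hV : Continuous V) (hV0 : ∀ x, 0 ≤ V x)
    (hψ : ContDiff ℝ 2 (Function.uncurry ψ))
    (hsol : ∀ t x, iteratedDeriv 2 (fun τ => ψ τ x) t - iteratedDeriv 2 (ψ t) x + V x * ψ t x = 0)
    (xc : ℝ) {ρ : ℝ} (hρ : 0 ≤ ρ) {s t : ℝ} (h0s : 0 ≤ s) (hst : s ≤ t) :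
    ∫⁻ x in {x : ℝ | ρ + |t| < |x - xc|}, ENNReal.ofReal
        (deriv (fun τ => ψ τ x) t ^ 2 + deriv (ψ t) x ^ 2 + V x * ψ t x ^ 2)
      ≤ ∫⁻ x in {x : ℝ | ρ + |s| < |x - xc|}, ENNReal.ofReal
        (deriv (fun τ => ψ τ x) s ^ 2 + deriv (ψ s) x ^ 2 + V x * ψ s x ^ 2) := by
  have hsplit : ∀ u : ℝ, 0 ≤ u →
      {x : ℝ | ρ + |u| < |x - xc|} = Ioi (xc + ρ + u) ∪ Iio (xc - ρ - u) := by
    intro u hu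
    ext x
    simp only [mem_setOf_eq, mem_union, mem_Ioi, mem_Iio, abs_of_nonneg hu]
    constructor
    · intro h
      rcases le_or_gt 0 (x - xc) with hx | hx
      · rw [abs_of_nonneg hx] at h; left; linarith
      · rw [abs_of_neg hx] at h; right; linarith
    · rintro (h | h)
      · exact lt_of_lt_of_le (by linarith) (le_abs_self _)
      · exact lt_of_lt_of_le (by linarith) (neg_le_abs _)
  have hdisj : ∀ u : ℝ, 0 ≤ u → Disjoint (Ioi (xc + ρ + u)) (Iio (xc - ρ - u)) := by
    intro u hu
    exact Set.disjoint_left.2 fun x hx hx' => by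
      simp only [mem_Ioi, mem_Iio] at hx hx'; linarith
  rw [hsplit t (h0s.trans hst), hsplit s h0s, lintegral_union measurableSet_Iio (hdisj t (h0s.trans hst)),
    lintegral_union measurableSet_Iio (hdisj s h0s)]
  refine add_le_add ?_ ?_
  · have := wave1D_lintegral_Ioi_energy_mono hV hV0 hψ hsol (c := xc + ρ) hst
    simpa [add_assoc] using this
  · have := wave1D_lintegral_Iio_energy_mono hV hV0 hψ hsol (c := xc - ρ) hst
    simpa [sub_sub] using this

/-- **Two-sided exterior energy is non-increasing backward in time**: same as
`wave1D_exteriorEnergy_mono_of_nonneg` for `t ≤ s ≤ 0` (time reversal). [folklore] -/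
theorem wave1D_exteriorEnergy_mono_of_nonpos (hV : Continuous V) (hV0 : ∀ x, 0 ≤ V x)
    (hψ : ContDiff ℝ 2 (Function.uncurry ψ))
    (hsol : ∀ t x, iteratedDeriv 2 (fun τ => ψ τ x) t - iteratedDeriv 2 (ψ t) x + V x * ψ t x = 0)
    (xc : ℝ) {ρ : ℝ} (hρ : 0 ≤ ρ) {s t : ℝ} (hs0 : s ≤ 0) (hts : t ≤ s) :
    ∫⁻ x in {x : ℝ | ρ + |t| < |x - xc|}, ENNReal.ofReal
        (deriv (fun τ => ψ τ x) t ^ 2 + deriv (ψ t) x ^ 2 + V x * ψ t x ^ 2)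
      ≤ ∫⁻ x in {x : ℝ | ρ + |s| < |x - xc|}, ENNReal.ofReal
        (deriv (fun τ => ψ τ x) s ^ 2 + deriv (ψ s) x ^ 2 + V x * ψ s x ^ 2) := by
  obtain ⟨hψ', hsol', he'⟩ := wave1D_timeReversal hψ hsol
  have h := wave1D_exteriorEnergy_mono_of_nonneg hV hV0 hψ' hsol' xc hρ (s := -s) (t := -t)
    (by linarith) (by linarith)
  simp only [he', abs_neg, neg_neg] at h
  exact h

/-- **The exterior energy never exceeds the initial exterior energy**: for every `t`,
`E_ext(t) ≤ E_ext(0) = ∫⁻_{ρ < |x − xc|} (ψ_t² + ψ_x² + Vψ²)(0,·)`. [folklore] -/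
theorem wave1D_exteriorEnergy_le_initial (hV : Continuous V) (hV0 : ∀ x, 0 ≤ V x)
    (hψ : ContDiff ℝ 2 (Function.uncurry ψ))
    (hsol : ∀ t x, iteratedDeriv 2 (fun τ => ψ τ x) t - iteratedDeriv 2 (ψ t) x + V x * ψ t x = 0)
    (xc : ℝ) {ρ : ℝ} (hρ : 0 ≤ ρ) (t : ℝ) :
    ∫⁻ x in {x : ℝ | ρ + |t| < |x - xc|}, ENNReal.ofReal
        (deriv (fun τ => ψ τ x) t ^ 2 + deriv (ψ t) x ^ 2 + V x * ψ t x ^ 2)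
      ≤ ∫⁻ x in {x : ℝ | ρ < |x - xc|}, ENNReal.ofReal
        (deriv (fun τ => ψ τ x) 0 ^ 2 + deriv (ψ 0) x ^ 2 + V x * ψ 0 x ^ 2) := by
  have h0 : {x : ℝ | ρ < |x - xc|} = {x : ℝ | ρ + |(0 : ℝ)| < |x - xc|} := by simp
  rw [h0]
  rcases le_total 0 t with ht | ht
  · exact wave1D_exteriorEnergy_mono_of_nonneg hV hV0 hψ hsol xc hρ le_rfl ht
  · exact wave1D_exteriorEnergy_mono_of_nonpos hV hV0 hψ hsol xc hρ le_rfl ht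

end Exterior

end Literature.Analysis.PDE
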